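import Literature.Analysis.FluidPDE.TsaiLocalEnergyProofs
import Literature.Analysis.FluidPDE.NecasRuzickaSverakRRS
import Literature.Analysis.FluidPDE.CKNLocalRegularityRRSStep2
import Literature.Analysis.FluidPDE.TsaiTheoremsFromStokes
import Literature.Analysis.FluidPDE.TsaiLemma41Proofs
import Literature.Analysis.FluidPDE.TsaiWeightedRieszPressureProofs
import Literature.Analysis.FluidPDE.CKNLocalEnergyEstimate
import Literature.Analysis.FluidPDE.CKNPressureEstimate
import Literature.Analysis.FluidPDE.CKNInterpolationEstimate
import Literature.Analysis.FluidPDE.TsaiSelfSimilarHolds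
import HarnessLib

/-!
# Tsai 1998, Lemma 4.2 and Theorem 2 from Robinson–Rodrigo–Sadowski's Thm. 15.3

Analysis/FluidPDE proofs file (theorems only: no definitions, no named facts) in the
decomposition of the named facts `Literature.Analysis.FluidPDE.tsai1998_lemma42`,
`Literature.Analysis.FluidPDE.tsai1998_top_singular_null` (`TsaiLocalEnergy.lean`) and
`Literature.Analysis.FluidPDE.tsai_selfsimilar_local_energy` (`SelfSimilarLiouville.lean`, **ns.S21**;
T.-P. Tsai, *On Leray's self-similar solutions of the Navier–Stokes equations satisfying local
energy estimates*, Arch. Rational Mech. Anal. 143 (1998) 29–51, **Lemma 4.2** (p. 46) and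
**Theorem 2** (p. 31)), and thereby of the barrier
`Literature.Barriers.NavierStokesRegularity.LeraySelfSimilarBlowupExclusion`.

## What is here (all proved)

The accepted `TsaiLocalEnergyProofs.lean` proves Lemma 4.2 at unit viscosity
(`tsai1998_lemma42_unit_of_estimates`) from the three Caffarelli–Kohn–Nirenberg decay estimates
of ns.S12 (`localEnergyEstimate`, `pressureEstimate`, `interpolationEstimate` — all three now
discharged: `localEnergyEstimate_holds`, `pressureEstimate_holds`, `interpolationEstimate_holds`)
and Lemarié-Rieusset's one-scale criterion **with force and arbitrary viscosity**
(`lemarieRieusset_epsilon_regularity`, Thm. 14.4), the latter being applied once, at `ν = 1`,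
`f = 0`, on the *top* cylinder `Q_{r_f}(t, x) ⊆ Q_ρ(T, x₀)` of the point. This file re-hangs
Lemma 4.2 — and with it Theorem 2 — on the lighter rendering of the one-scale criterion that the
tree reduces to Robinson–Rodrigo–Sadowski's Lemma 15.12 alone, namely the conclusion `H` of
`epsilonRegularity_one_of_theorem15_3` (`NecasRuzickaSverakRRS.lean`: `ν = 1`, `f = 0`, cylinders
whose *closed* box lies in the region, from `RRS2016.theorem15_3`; and
`RRS2016.theorem15_3_of_lemma15_12`, `CKNLocalRegularityRRSStep2.lean`, with Lemma 15.11 and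
Steps 1–4 proved):

* `tsai1998_lemma42_unit_of_oneScale` — Lemma 4.2 at `ν = 1` from the three decay estimates and
  `H`. The proof is that of `tsai1998_lemma42_unit_of_estimates` verbatim up to the output of the
  decay scheme at the centres shifted into the past — `C(r_f; (t-h, x)) + D(r_f; (t-h, x)) ≤ ε₀³`
  for every `0 < h ≤ min(r₁², 3r_f²)`, with `r_f` independent of `h` — followed by a different
  endgame which never touches the top: `H` is applied on each *shifted* cylinder
  `Q_{r_f}(t-h, x)`, whose closed box lies in `Q_ρ(T, x₀)` because `h > 0`, giving
  `|u| ≤ C₀ε₀/r_f` a.e. on `Q_{r_f/2}(t-h, x)` uniformly in `h`; and the half-cylinder at the point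
  is exhausted by the shifted ones, `Q_{r_f/2}(t, x) ⊆ ⋃ₙ Q_{r_f/2}(t-hₙ, x)` for any `hₙ ↓ 0`
  (a point `(s, y)` with `s < t` lies in `Q_{r_f/2}(t-hₙ, x)` as soon as `hₙ < t - s`), so the
  uniform a.e. bound passes to `Q_{r_f/2}(t, x)` (`ae_restrict_iUnion_iff`). (Caffarelli–Kohn–
  Nirenberg's own device for boundary-in-time points is the same union of interior cylinders,
  1982, §6.)
* `tsai1998_lemma42_of_theorem15_3 : RRS2016.theorem15_3 → tsai1998_lemma42` (all viscosities by
  the accepted rescaling `tsai1998_lemma42_of_unit`), `tsai1998_top_singular_null_of_theorem15_3`,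
  and `tsai1998_lemma42_of_lemma15_12 : RRS2016.lemma15_12 → tsai1998_lemma42`;
* `tsai1998_lemma41_holds : tsai1998_lemma41` — the discharge of Tsai's Lemma 4.1 announced in
  `TsaiLemma41Proofs.lean` (`tsai1998_lemma41_of_weightedRiesz` applied to the discharged
  weighted Riesz-transform bound `tsai1998_weightedRieszPressure_holds`);
* `tsai_selfsimilar_local_energy_of_theorem15_3 : RRS2016.theorem15_3 → tsai_selfsimilar_local_energy`
  and `tsai_selfsimilar_local_energy_of_lemma15_12 : RRS2016.lemma15_12 → tsai_selfsimilar_local_energy`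
  — **Tsai's Theorem 2 with trust base `{RRS2016.lemma15_12}`** (Robinson–Rodrigo–Sadowski 2016,
  Lemma 15.12, the local pressure estimate), via the accepted `tsai_selfsimilar_local_energy_of_stokes`
  with `tsai1998_profile_smooth_holds`, `stokes_interior_Lr_estimate_holds`, `tsai1998_lemma41_holds`;
* `tsai_selfsimilar_local_energy_of_LR : lemarieRieusset_epsilon_regularity → tsai_selfsimilar_local_energy`
  — the accepted chain `tsai_selfsimilar_local_energy_of_weightedRiesz_of_estimates` with every
  other input discharged (`tsai_selfsimilar_holds`, `TsaiSelfSimilarHolds.lean`), kept for the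
  dependents of Thm. 14.4.

So after this file the three conjuncts of the Leray self-similar blow-up barrier stand as follows:
`tsai_selfsimilar` proved (`tsai_selfsimilar_holds`); `necas_ruzicka_sverak` and
`tsai_selfsimilar_local_energy` both conditional on the single named fact `RRS2016.lemma15_12`
(`necas_ruzicka_sverak_of_RRS_steps` with `RRS2016.step2_force_holds`, resp.
`tsai_selfsimilar_local_energy_of_lemma15_12`), or alternatively on `lemarieRieusset_epsilon_regularity`.

## Mathlib / tree search

Tree (all used): `tsai1998_lemma42_of_unit`, `ofReal_two_mul`, `inv_ofReal_eq_two_mul_inv`,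
`cknF_zero_force`, `ae_lintegral_indicator_prod_le`, `tsai_selfsimilar_local_energy_of_estimates`
(`TsaiLocalEnergyProofs`); `CKN1982.decay_scheme` (`CKNDecayScheme`); `real_localEnergy`,
`real_pressure`, `real_interpolation`, `real_force`, `add_le_ofReal_of_real`,
`closure_parabolicCylinder_subset`, `cknE_le_of_subset`, `cknD_le_of_subset`,
`locallyIntegrableOn_of_memLp` (`CKNEpsilonRegularityAssembly`); `exists_forall_lt_of_limsup_le`,
`cknAEss_le_of_energy` (`CKN1982Setting`); `HasWeakSpatialGradientOn.ae_eq` (`NSSuitableESSProofs`);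
`epsilonRegularity_one_of_theorem15_3` (`NecasRuzickaSverakRRS`);
`RRS2016.theorem15_3_of_lemma15_12` (`CKNLocalRegularityRRSStep2`);
`tsai_selfsimilar_local_energy_of_stokes` (`TsaiTheoremsFromStokes`);
`tsai1998_lemma41_of_weightedRiesz`, `tsai_selfsimilar_local_energy_of_weightedRiesz_of_estimates`
(`TsaiLemma41Proofs`); the discharges `tsai1998_weightedRieszPressure_holds`,
`localEnergyEstimate_holds`, `pressureEstimate_holds`, `interpolationEstimate_holds`,
`tsai1998_profile_smooth_holds`, `stokes_interior_Lr_estimate_holds`, `tsai_selfsimilar_holds`.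
Mathlib: `ae_restrict_iUnion_iff`, `ae_restrict_of_ae_restrict_of_subset`,
`eLpNormEssSup_lt_top_of_ae_bound`, `exists_nat_gt`, `closedBall_subset_ball'`.
`lean search 'tsai1998_lemma42_of'`, `'of_theorem15_3'`, `'oneScale'`: the only earlier consumers of
Thm. 15.3 in this shape are `necas_ruzicka_sverak_of_theorem15_3` and the Rusin–Šverák
reductions (`RRS2016.theorem15_3.unforced_oneScale`, interior cylinders, qualitative bound),
none of which reaches the top of a cylinder.

## References

* T.-P. Tsai, *On Leray's self-similar solutions of the Navier–Stokes equations satisfying local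
  energy estimates*, Arch. Rational Mech. Anal. 143 (1998) 29–51: Theorem 2 (p. 31), Lemma 4.1,
  Lemma 4.2 and the following remark, Corollary 4.3 (p. 46), proof of Theorem 2 (p. 47).
  [Tsai1998]
* J. C. Robinson, J. L. Rodrigo, W. Sadowski, *The three-dimensional Navier–Stokes equations*,
  CUP (2016): Thm. 15.3 (p. 220), Lemma 15.12 (pp. 232–234), Lemma 15.10, (16.13), Lemma 16.7.
  [RobinsonRodrigoSadowski2016]
* L. Caffarelli, R. Kohn, L. Nirenberg, *Partial regularity of suitable weak solutions of the
  Navier–Stokes equations*, Comm. Pure Appl. Math. 35 (1982) 771–831: Propositions 1–2, §6.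
  [CaffarelliKohnNirenberg1982]
* P. G. Lemarié-Rieusset, *The Navier–Stokes Problem in the 21st Century*, CRC Press (2016):
  Thm. 14.4 (p. 505). [LemarieRieusset2016]
-/

noncomputable section

open MeasureTheory Set Function Filter Topology TopologicalSpace Metric
open scoped NNReal ENNReal InnerProductSpace RealInnerProductSpace

namespace Literature.Analysis.FluidPDE

/-- Local notation for physical space `ℝ³ = EuclideanSpace ℝ (Fin 3)`. -/
local notation "ℝ³" => EuclideanSpace ℝ (Fin 3)

/-! ## Lemma 4.2 at unit viscosity from the three decay estimates and the conclusion of the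
one-scale criterion on interior cylinders -/

/-- **Tsai 1998, Lemma 4.2 at unit viscosity, from the Caffarelli–Kohn–Nirenberg decay estimates
and the one-scale criterion on interior cylinders** (p. 46: "a variant of Proposition 2 of [CKN] …
replacing `Q*_r(x, t)` by `Q_r(x, t)` … It assumes the information only at times previous to `t`,
and gets control only at times previous to `t`"). The statement is the body of the accepted
`tsai1998_lemma42` at `ν = 1` (word for word the conclusion of
`tsai1998_lemma42_unit_of_estimates`): there is `ε > 0` such that for a suitable weak solution
`(u, p)` (zero force) on `Q_ρ(T, x₀)` in CKN's class on the whole cylinder and a point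
`z = (t, x)`, `T - ρ² < t ≤ T`, `x ∈ B_ρ(x₀)`, `limsup_{r→0⁺} r⁻¹ ∫∫_{Q_r(z)} |∇u|² ≤ ε` implies
`u ∈ L^∞(Q_{r₁}(z))` for some `r₁ > 0`. Inputs: `localEnergyEstimate`, `pressureEstimate`,
`interpolationEstimate` (run through `CKN1982.decay_scheme` at the centres `(t - h, x)` shifted
into the past, uniformly in `0 < h ≤ min(r₁², 3r_f²)`, exactly as in
`tsai1998_lemma42_unit_of_estimates`) and the *conclusion* `H` of the one-scale criterion at
`ν = 1`, `f = 0`, for cylinders whose closed box lies in the region, with threshold `ε₀ > 0` and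
constant `Cε` (as supplied by `epsilonRegularity_one_of_theorem15_3`): `H` bounds `|u|` by
`Cε ε₀ / r_f` a.e. on every shifted half-cylinder `Q_{r_f/2}(t - h, x)`, and
`Q_{r_f/2}(t, x) ⊆ ⋃ₙ Q_{r_f/2}(t - hₙ, x)`, `hₙ ↓ 0` (module docstring). [cite: Tsai1998, Lemma 4.2 (p. 46)] -/
theorem tsai1998_lemma42_unit_of_oneScale (hLE : localEnergyEstimate) (hPE : pressureEstimate)
    (hIE : interpolationEstimate) {ε₀ Cε : ℝ} (hε₀ : 0 < ε₀)
    (H : ∀ (Q : Opens (ℝ × ℝ³)) (u : ℝ → ℝ³ → ℝ³) (p : ℝ → ℝ³ → ℝ),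
      IsSuitableWeakSolutionOn Q 1 0 u p →
      ∀ (z₀ : ℝ × ℝ³) (r₀ r₁ : ℝ), 0 < r₀ → r₀ ≤ r₁ →
        Icc (z₀.1 - r₁ ^ 2) z₀.1 ×ˢ closedBall z₀.2 r₁ ⊆ (Q : Set (ℝ × ℝ³)) →
        ∫⁻ w in parabolicCylinder r₀ z₀, (‖u w.1 w.2‖ₑ ^ (3 : ℕ) + ‖p w.1 w.2‖ₑ ^ (3 / 2 : ℝ)) ≤
          ENNReal.ofReal (ε₀ ^ 3 * r₀ ^ 2) →
        ∀ᵐ w ∂(volume.restrict (parabolicCylinder (r₀ / 2) z₀)), ‖u w.1 w.2‖ ≤ Cε * ε₀ / r₀) :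
    ∃ ε : ℝ, 0 < ε ∧
    ∀ (ρ T : ℝ) (x₀ : ℝ³) (u : ℝ → ℝ³ → ℝ³) (p : ℝ → ℝ³ → ℝ) (G : ℝ → ℝ³ → ℝ³ →L[ℝ] ℝ³),
      0 < ρ →
      IsSuitableWeakSolutionOn (parabolicCylinderOpens ρ (T, x₀)) 1 0 u p →
      (∃ C : ℝ≥0, ∀ᵐ t : ℝ, t ∈ Ioo (T - ρ ^ 2) T → ∫⁻ x in ball x₀ ρ, ‖u t x‖ₑ ^ 2 ≤ C) →
      HasWeakSpatialGradientOn (parabolicCylinderOpens ρ (T, x₀)) u G →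
      ∫⁻ z in parabolicCylinder ρ (T, x₀), ENNReal.ofReal (frobeniusNormSq (G z.1 z.2)) < ∞ →
      ∫⁻ z in parabolicCylinder ρ (T, x₀), ‖p z.1 z.2‖ₑ ^ (3 / 2 : ℝ) < ∞ →
      ∀ z : ℝ × ℝ³, z.1 ∈ Ioc (T - ρ ^ 2) T → z.2 ∈ ball x₀ ρ →
        limsup (fun r : ℝ => (ENNReal.ofReal r)⁻¹ *
            ∫⁻ w in parabolicCylinder r z, ENNReal.ofReal (frobeniusNormSq (G w.1 w.2)))
          (𝓝[>] (0 : ℝ)) ≤ ENNReal.ofReal ε →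
        ∃ r₁ : ℝ, 0 < r₁ ∧
          eLpNorm (uncurry u) ∞ (volume.restrict (parabolicCylinder r₁ z)) < ∞ := by
  obtain ⟨κ₁, κ₂, κ₃, κ₄, hLE⟩ := hLE
  obtain ⟨κ₅, κ₆, hPE⟩ := hPE
  obtain ⟨C₀, hIE⟩ := hIE
  -- the abstract scheme with the real constants
  obtain ⟨θ, hθ, hθhalf, hscheme⟩ := CKN1982.decay_scheme (κ₁ := (κ₁ : ℝ)) (κ₂ := (κ₂ : ℝ))
    (κ₃ := (κ₃ : ℝ)) (κ₄ := (κ₄ : ℝ))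
    (κ₅ := (2 : ℝ) ^ (1 / 3 : ℝ) * (κ₅ : ℝ) ^ (4 / 3 : ℝ))
    (κ₆ := (2 : ℝ) ^ (1 / 3 : ℝ) * (κ₆ : ℝ) ^ (4 / 3 : ℝ)) (C₀ := (C₀ : ℝ))
    κ₁.coe_nonneg κ₂.coe_nonneg κ₃.coe_nonneg κ₄.coe_nonneg (by positivity) (by positivity)
    C₀.coe_nonneg
  have hθ1 : θ ≤ 1 := hθhalf.trans (by norm_num)
  obtain ⟨ε, hε, η, hη, hsteps⟩ := hscheme (ε₀ ^ 3) (by positivity)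
  refine ⟨ε / 4, by positivity, ?_⟩
  rintro ρ T x₀ u p G hρ hsws ⟨CE, hCE⟩ hG hGint hp ⟨t, x⟩ hzt hzx hlim
  dsimp only at hzt hzx
  set Q : Opens (ℝ × ℝ³) := parabolicCylinderOpens ρ (T, x₀) with hQdef
  have hQ : (Q : Set (ℝ × ℝ³)) = parabolicCylinder ρ (T, x₀) := rfl
  -- the gradient carrying the local energy inequality, and its identification with `G`
  obtain ⟨G₀, hG₀, -, -⟩ := hsws.localEnergy
  set F : ℝ × ℝ³ → ℝ≥0∞ := fun w => ENNReal.ofReal (frobeniusNormSq (G w.1 w.2)) with hF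
  set F₀ : ℝ × ℝ³ → ℝ≥0∞ := fun w => ENNReal.ofReal (frobeniusNormSq (G₀ w.1 w.2)) with hF₀
  have hae : ∀ᵐ w ∂(volume.restrict (Q : Set (ℝ × ℝ³))), F₀ w = F w := by
    filter_upwards [hG₀.ae_eq hG] with w hw
    simp only [hF, hF₀]
    change ENNReal.ofReal (frobeniusNormSq (uncurry G₀ w)) =
      ENNReal.ofReal (frobeniusNormSq (uncurry G w))
    rw [hw]
  have hFF : ∀ S : Set (ℝ × ℝ³), S ⊆ (Q : Set (ℝ × ℝ³)) → ∫⁻ w in S, F₀ w = ∫⁻ w in S, F w :=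
    fun S hS => lintegral_congr_ae (ae_restrict_of_ae_restrict_of_subset hS hae)
  have hG₀int : ∫⁻ w in (Q : Set (ℝ × ℝ³)), F₀ w < ∞ := by
    rw [hFF _ Subset.rfl, hQ]
    exact hGint
  -- the energy class in indicator form
  have hCEind : ∀ᵐ s : ℝ, ∫⁻ y, (Q : Set (ℝ × ℝ³)).indicator
      (fun w : ℝ × ℝ³ => ‖u w.1 w.2‖ₑ ^ 2) (s, y) ≤ CE := by
    rw [hQ, parabolicCylinder]
    exact ae_lintegral_indicator_prod_le measurableSet_ball hCE
  have hp' : ∫⁻ w in (Q : Set (ℝ × ℝ³)), ‖p w.1 w.2‖ₑ ^ (3 / 2 : ℝ) < ∞ := by rw [hQ]; exact hp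
  -- the zero force
  have hfq : MemLp (uncurry (0 : ℝ → ℝ³ → ℝ³)) (ENNReal.ofReal 3)
      (volume.restrict (Q : Set (ℝ × ℝ³))) :=
    (MemLp.zero : MemLp (0 : ℝ × ℝ³ → ℝ³) (ENNReal.ofReal 3) (volume.restrict (Q : Set (ℝ × ℝ³))))
  have hfli : LocallyIntegrableOn (uncurry (0 : ℝ → ℝ³ → ℝ³)) (Q : Set (ℝ × ℝ³)) volume :=
    locallyIntegrableOn_of_memLp (by norm_num) hfq
  have hdiv : ∀ φ : ℝ → ℝ³ → ℝ, IsSpaceTimeTestOn Q φ →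
      ∫ s, ∫ y, ⟪(0 : ℝ → ℝ³ → ℝ³) s y, gradient (φ s) y⟫ = 0 := fun φ _ => by simp
  have hF0 : ∀ (r : ℝ) (w : ℝ × ℝ³), cknF 3 r w (0 : ℝ → ℝ³ → ℝ³) = 0 :=
    fun r w => cknF_zero_force (by norm_num) r w
  -- ## geometry: the margins of the point `(t, x)` inside `Q`
  have hgt : 0 < t - (T - ρ ^ 2) := sub_pos.2 hzt.1
  have hgx : 0 < ρ - dist x x₀ := sub_pos.2 (mem_ball.1 hzx)
  obtain ⟨r₁, hr₁, hr₁t, hr₁x⟩ : ∃ r₁ : ℝ, 0 < r₁ ∧ 4 * r₁ ^ 2 < t - (T - ρ ^ 2) ∧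
      2 * r₁ < ρ - dist x x₀ := by
    set g : ℝ := min (t - (T - ρ ^ 2)) (ρ - dist x x₀) with hg
    have hg0 : 0 < g := lt_min hgt hgx
    refine ⟨min (g / 4) (1 / 2), by positivity, ?_, ?_⟩
    · have h1 : 2 * min (g / 4) (1 / 2) ≤ g / 2 := by linarith [min_le_left (g / 4) (1 / 2)]
      have h2 : 2 * min (g / 4) (1 / 2) ≤ 1 := by linarith [min_le_right (g / 4) (1 / 2)]
      have h3 : 0 ≤ 2 * min (g / 4) (1 / 2) := by positivity
      calc 4 * min (g / 4) (1 / 2) ^ 2 = (2 * min (g / 4) (1 / 2)) * (2 * min (g / 4) (1 / 2)) := by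
            ring
        _ ≤ g / 2 * 1 := mul_le_mul h1 h2 h3 (by positivity)
        _ < g := by linarith
        _ ≤ t - (T - ρ ^ 2) := min_le_left _ _
    · calc 2 * min (g / 4) (1 / 2) ≤ 2 * (g / 4) := by gcongr; exact min_le_left _ _
        _ < g := by linarith
        _ ≤ ρ - dist x x₀ := min_le_right _ _
  -- shifted cylinders `Q_r(t - h, x)`, `0 < h ≤ r₁²`, `0 < r ≤ r₁`, have closure inside `Q`
  have hclQ : ∀ h r, 0 < h → h ≤ r₁ ^ 2 → 0 < r → r ≤ r₁ →
      closure (parabolicCylinder r (t - h, x)) ⊆ (Q : Set (ℝ × ℝ³)) := by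
    intro h r hh0 hh hr hrr
    refine (closure_parabolicCylinder_subset r _).trans ?_
    rw [hQ, parabolicCylinder]
    refine prod_mono ?_ ?_
    · intro s hs
      simp only [mem_Icc] at hs
      simp only [mem_Ioo]
      have : r ^ 2 ≤ r₁ ^ 2 := pow_le_pow_left₀ hr.le hrr 2
      constructor <;> nlinarith [hzt.2]
    · exact closedBall_subset_ball' (by simp only; linarith [hrr])
  -- the doubled cylinders `Q_{2r}(t, x)`, `0 < r ≤ r₁`, lie inside `Q`
  have hdblQ : ∀ r, 0 < r → r ≤ r₁ → parabolicCylinder (2 * r) (t, x) ⊆ (Q : Set (ℝ × ℝ³)) := by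
    intro r hr hrr
    rw [hQ, parabolicCylinder, parabolicCylinder]
    refine prod_mono ?_ (ball_subset_ball' (by simp only; linarith))
    simp only
    have : r ^ 2 ≤ r₁ ^ 2 := pow_le_pow_left₀ hr.le hrr 2
    exact Ioo_subset_Ioo (by nlinarith) hzt.2
  -- a shifted cylinder lies in the doubled one: `Q_r(t - h, x) ⊆ Q_{2r}(t, x)` for `0 ≤ h ≤ 3r²`
  have hshift : ∀ h r, 0 ≤ h → 0 < r → h ≤ 3 * r ^ 2 →
      parabolicCylinder r (t - h, x) ⊆ parabolicCylinder (2 * r) (t, x) := by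
    intro h r hh0 hr hh
    rw [parabolicCylinder, parabolicCylinder]
    refine prod_mono ?_ (ball_subset_ball (by linarith))
    simp only
    exact Ioo_subset_Ioo (by nlinarith) (by linarith)
  -- ## the scale `r_E` below which the dissipation around `(t, x)` is `< ε/2`
  obtain ⟨rE, hrE, hElt⟩ := exists_forall_lt_of_limsup_le hlim
    ((ENNReal.ofReal_lt_ofReal_iff (by positivity)).2 (by linarith : ε / 4 < ε / 2))
  -- the starting scale `r₀`
  obtain ⟨r₀, hr₀, hr₀r₁, hr₀E⟩ : ∃ r₀ : ℝ, 0 < r₀ ∧ r₀ ≤ r₁ ∧ 2 * r₀ < rE :=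
    ⟨min r₁ (rE / 4), by positivity, min_le_left _ _,
      by linarith [min_le_right r₁ (rE / 4)]⟩
  -- the a-priori bound `M` and the number of steps `k`
  set Np : ℝ≥0∞ := ∫⁻ w in (Q : Set (ℝ × ℝ³)), ‖p w.1 w.2‖ₑ ^ (3 / 2 : ℝ) with hNp
  obtain ⟨k, hk⟩ := hsteps
    (((ENNReal.ofReal r₀)⁻¹ * CE).toReal + ((((ENNReal.ofReal r₀) ^ 2)⁻¹ * Np) ^ (4 / 3 : ℝ)).toReal)
  -- the last scale `rf`
  obtain ⟨rf, hrfdef⟩ : ∃ rf : ℝ, rf = θ ^ k * r₀ := ⟨_, rfl⟩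
  have hrf : 0 < rf := by rw [hrfdef]; positivity
  have hrfr₀ : rf ≤ r₀ := by
    rw [hrfdef]; exact mul_le_of_le_one_left hr₀.le (pow_le_one₀ hθ.le hθ1)
  have hrfr₁ : rf ≤ r₁ := hrfr₀.trans hr₀r₁
  -- the scales `s j = θʲ r₀`
  have hs0 : ∀ j : ℕ, 0 < θ ^ j * r₀ := fun j => by positivity
  have hsr₀ : ∀ j : ℕ, θ ^ j * r₀ ≤ r₀ := fun j =>
    mul_le_of_le_one_left hr₀.le (pow_le_one₀ hθ.le hθ1)
  have hsrf : ∀ j ≤ k, rf ≤ θ ^ j * r₀ := fun j hj => by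
    rw [hrfdef]
    exact mul_le_mul_of_nonneg_right (pow_le_pow_of_le_one hθ.le hθ1 hj) hr₀.le
  have hsucc : ∀ j : ℕ, θ * (θ ^ j * r₀) = θ ^ (j + 1) * r₀ := fun j => by rw [pow_succ]; ring
  -- ## the decay scheme at the shifted centres `(t - h, x)`, `0 < h ≤ min r₁² (3 rf²)`
  have hstep : ∀ h : ℝ, 0 < h → h ≤ r₁ ^ 2 → h ≤ 3 * rf ^ 2 →
      cknC rf (t - h, x) u + cknD rf (t - h, x) p ≤ ENNReal.ofReal (ε₀ ^ 3) := by
    intro h hh0 hhr₁ hhrf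
    set z' : ℝ × ℝ³ := (t - h, x) with hz'
    have hclQ' : ∀ r, 0 < r → r ≤ r₀ → closure (parabolicCylinder r z') ⊆ (Q : Set (ℝ × ℝ³)) :=
      fun r hr hrr => hclQ h r hh0 hhr₁ hr (hrr.trans hr₀r₁)
    have hsubQ : ∀ r, 0 < r → r ≤ r₀ → parabolicCylinder r z' ⊆ (Q : Set (ℝ × ℝ³)) :=
      fun r hr hrr => subset_closure.trans (hclQ' r hr hrr)
    -- finiteness of the scaled quantities at admissible radii
    have hAle : ∀ r, 0 < r → r ≤ r₀ → cknAEss r z' u ≤ (ENNReal.ofReal r)⁻¹ * CE :=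
      fun r hr hrr => cknAEss_le_of_energy hCEind (hsubQ r hr hrr)
    have hAfin : ∀ r, 0 < r → r ≤ r₀ → cknAEss r z' u ≠ ∞ := fun r hr hrr =>
      ne_top_of_le_ne_top (ENNReal.mul_ne_top (ENNReal.inv_ne_top.2 (ENNReal.ofReal_pos.2 hr).ne')
        ENNReal.coe_ne_top) (hAle r hr hrr)
    have hEfin : ∀ r, 0 < r → r ≤ r₀ → cknE r z' G₀ ≠ ∞ := fun r hr hrr =>
      ne_top_of_le_ne_top (ENNReal.mul_ne_top (ENNReal.inv_ne_top.2 (ENNReal.ofReal_pos.2 hr).ne')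
        hG₀int.ne) (cknE_le_of_subset G₀ (hsubQ r hr hrr))
    have hDfin : ∀ r, 0 < r → r ≤ r₀ → cknD r z' p ≠ ∞ := fun r hr hrr =>
      ne_top_of_le_ne_top (ENNReal.mul_ne_top
        (ENNReal.inv_ne_top.2 (pow_ne_zero 2 (ENNReal.ofReal_pos.2 hr).ne')) hp'.ne)
        (cknD_le_of_subset p (hsubQ r hr hrr))
    have hFfin : ∀ r, cknF 3 r z' (0 : ℝ → ℝ³ → ℝ³) ≠ ∞ := fun r => by
      rw [hF0]; exact ENNReal.zero_ne_top
    have hGr : ∀ r, 0 < r → r ≤ r₀ →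
        HasWeakSpatialGradientOn (parabolicCylinderOpens r z') u G₀ :=
      fun r hr hrr => hG₀.mono (hsubQ r hr hrr)
    have hCfin : ∀ r, 0 < r → r ≤ r₀ → cknC r z' u ≠ ∞ := fun r hr hrr =>
      ne_top_of_le_ne_top (ENNReal.mul_ne_top ENNReal.coe_ne_top (ENNReal.rpow_ne_top_of_nonneg
        (by norm_num) (ENNReal.add_ne_top.2 ⟨hAfin r hr hrr, hEfin r hr hrr⟩)))
        (hIE u G₀ z' r hr (hGr r hr hrr) (hAfin r hr hrr) (hEfin r hr hrr))
    -- the dissipation inputs are small: `E(s; z') ≤ 2 E(2s; (t, x)) < ε` for `rf ≤ s ≤ r₀`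
    have hEsmall : ∀ j ≤ k, (cknE (θ ^ j * r₀) z' G₀).toReal ≤ ε := by
      intro j hj
      have hs := hs0 j
      have hle3 : h ≤ 3 * (θ ^ j * r₀) ^ 2 :=
        hhrf.trans (by nlinarith [hsrf j hj, hrf])
      have h1 : cknE (θ ^ j * r₀) z' G₀ ≤
          2 * ((ENNReal.ofReal (2 * (θ ^ j * r₀)))⁻¹ *
            ∫⁻ w in parabolicCylinder (2 * (θ ^ j * r₀)) (t, x), F w) := by
        have e1 : cknE (θ ^ j * r₀) z' G₀ =
            (ENNReal.ofReal (θ ^ j * r₀))⁻¹ * ∫⁻ w in parabolicCylinder (θ ^ j * r₀) z', F w := by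
          rw [cknE, ← hFF _ (hsubQ _ hs (hsr₀ j)), hF₀]
        rw [e1, ← mul_assoc, ← inv_ofReal_eq_two_mul_inv]
        exact mul_le_mul_right (lintegral_mono_set (hshift h _ hh0.le hs hle3)) _
      have h2 : (ENNReal.ofReal (2 * (θ ^ j * r₀)))⁻¹ *
          ∫⁻ w in parabolicCylinder (2 * (θ ^ j * r₀)) (t, x), F w < ENNReal.ofReal (ε / 2) :=
        hElt _ (by positivity) (by nlinarith [hsr₀ j])
      refine ENNReal.toReal_le_of_le_ofReal hε.le (h1.trans ?_)
      calc 2 * ((ENNReal.ofReal (2 * (θ ^ j * r₀)))⁻¹ *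
            ∫⁻ w in parabolicCylinder (2 * (θ ^ j * r₀)) (t, x), F w)
          ≤ 2 * ENNReal.ofReal (ε / 2) := mul_le_mul_right h2.le _
        _ = ENNReal.ofReal ε := by rw [← ofReal_two_mul]; congr 1; ring
    -- the real sequences and the scheme
    have hmain := hk (fun j => (cknAEss (θ ^ j * r₀) z' u).toReal)
      (fun j => (cknE (θ ^ j * r₀) z' G₀).toReal)
      (fun j => (cknD (θ ^ j * r₀) z' p ^ (4 / 3 : ℝ)).toReal)
      (fun j => (cknF 3 (θ ^ j * r₀) z' (0 : ℝ → ℝ³ → ℝ³) ^ (2 / (3 : ℝ))).toReal)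
      ((cknC (θ ^ k * r₀) z' u).toReal)
      (fun j => ENNReal.toReal_nonneg) (fun j => ENNReal.toReal_nonneg)
      (fun j => ENNReal.toReal_nonneg) (fun j => ENNReal.toReal_nonneg) ENNReal.toReal_nonneg
      (fun j hj => by
        -- local-energy estimate at `(s j, θ)`
        have H := hLE Q 3 0 u p G₀ hsws (by norm_num) hfq hG₀ z' (θ ^ j * r₀) θ (hs0 j) hθ hθhalf
          (hclQ' _ (hs0 j) (hsr₀ j))
        rw [hsucc j] at H
        exact real_localEnergy le_self_add H (by norm_num) (hAfin _ (hs0 j) (hsr₀ j))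
          (hEfin _ (hs0 j) (hsr₀ j)) (hDfin _ (hs0 j) (hsr₀ j)) (hFfin _))
      (fun j hj => by
        -- pressure estimate at `(s j, θ)`
        have H := hPE Q 0 u p G₀ hsws hfli hdiv hG₀ z' (θ ^ j * r₀) θ (hs0 j) hθ hθhalf
          (hclQ' _ (hs0 j) (hsr₀ j))
        rw [hsucc j] at H
        exact real_pressure hθ hθ1 H (hAfin _ (hs0 j) (hsr₀ j)) (hEfin _ (hs0 j) (hsr₀ j))
          (hDfin _ (hs0 j) (hsr₀ j)))
      (by
        -- interpolation at the last scale
        exact real_interpolation (hIE u G₀ z' (θ ^ k * r₀) (hs0 k) (hGr _ (hs0 k) (hsr₀ k))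
          (hAfin _ (hs0 k) (hsr₀ k)) (hEfin _ (hs0 k) (hsr₀ k))) (hAfin _ (hs0 k) (hsr₀ k))
          (hEfin _ (hs0 k) (hsr₀ k)))
      hEsmall
      (fun j hj => by
        -- force smallness (the force vanishes)
        refine real_force (q := 3) (by norm_num) hη.le ?_
        rw [hF0]
        exact zero_le)
      (by
        -- the a-priori bound at `r₀`
        have e0 : θ ^ 0 * r₀ = r₀ := by simp
        simp only [e0]
        have hA0 : cknAEss r₀ z' u ≤ (ENNReal.ofReal r₀)⁻¹ * CE := hAle r₀ hr₀ le_rfl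
        have hD0 : cknD r₀ z' p ^ (4 / 3 : ℝ) ≤ (((ENNReal.ofReal r₀) ^ 2)⁻¹ * Np) ^ (4 / 3 : ℝ) :=
          ENNReal.rpow_le_rpow (cknD_le_of_subset p (hsubQ r₀ hr₀ le_rfl)) (by norm_num)
        have hfinA : (ENNReal.ofReal r₀)⁻¹ * (CE : ℝ≥0∞) ≠ ∞ :=
          ENNReal.mul_ne_top (ENNReal.inv_ne_top.2 (ENNReal.ofReal_pos.2 hr₀).ne') ENNReal.coe_ne_top
        have hfinD : (((ENNReal.ofReal r₀) ^ 2)⁻¹ * Np) ^ (4 / 3 : ℝ) ≠ ∞ :=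
          ENNReal.rpow_ne_top_of_nonneg (by norm_num) (ENNReal.mul_ne_top
            (ENNReal.inv_ne_top.2 (pow_ne_zero 2 (ENNReal.ofReal_pos.2 hr₀).ne')) hp'.ne)
        exact add_le_add (ENNReal.toReal_mono hfinA hA0) (ENNReal.toReal_mono hfinD hD0))
    -- back to `ℝ≥0∞`
    beta_reduce at hmain
    rw [← hrfdef] at hmain
    exact add_le_ofReal_of_real (hCfin rf hrf hrfr₀) (hDfin rf hrf hrfr₀) hmain

  -- ## the one-scale criterion at the shifted centres `(t - h, x)`, `0 < h ≤ min r₁² (3 rf²)`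
  -- the closed boxes of the shifted cylinders `Q_rf(t - h, x)` lie in `Q`
  have hboxQ : ∀ h, 0 < h → h ≤ r₁ ^ 2 →
      Icc ((t - h) - rf ^ 2) (t - h) ×ˢ closedBall x rf ⊆ (Q : Set (ℝ × ℝ³)) := by
    intro h hh0 hh
    rw [hQ, parabolicCylinder]
    refine prod_mono ?_ ?_
    · intro s hs
      simp only [mem_Icc] at hs
      simp only [mem_Ioo]
      have : rf ^ 2 ≤ r₁ ^ 2 := pow_le_pow_left₀ hrf.le hrfr₁ 2
      constructor <;> nlinarith [hzt.2]
    · exact closedBall_subset_ball' (by simp only; linarith [hrfr₁])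
  -- the smallness at the shifted centres in the integrated form `∫∫ (|u|³ + |p|^{3/2}) ≤ ε₀³ rf²`
  have hsmallH : ∀ h, 0 < h → h ≤ r₁ ^ 2 → h ≤ 3 * rf ^ 2 →
      ∫⁻ w in parabolicCylinder rf (t - h, x),
          (‖u w.1 w.2‖ₑ ^ (3 : ℕ) + ‖p w.1 w.2‖ₑ ^ (3 / 2 : ℝ)) ≤
        ENNReal.ofReal (ε₀ ^ 3 * rf ^ 2) := by
    intro h hh0 hhr₁ hhrf
    have hsub : parabolicCylinder rf (t - h, x) ⊆ (Q : Set (ℝ × ℝ³)) :=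
      subset_closure.trans (hclQ h rf hh0 hhr₁ hrf hrfr₁)
    have hmeas_u : AEMeasurable (fun w : ℝ × ℝ³ => ‖u w.1 w.2‖ₑ ^ (3 : ℕ))
        (volume.restrict (parabolicCylinder rf (t - h, x))) := by
      have h1 : AEStronglyMeasurable (uncurry u)
          (volume.restrict (parabolicCylinder rf (t - h, x))) :=
        hsws.distributional.1.aestronglyMeasurable.mono_measure (Measure.restrict_mono hsub le_rfl)
      exact h1.aemeasurable.enorm.pow_const 3
    rw [lintegral_add_left' hmeas_u]
    have hc0 : (ENNReal.ofReal rf ^ 2) ≠ 0 := pow_ne_zero 2 (ENNReal.ofReal_pos.2 hrf).ne'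
    have hctop : (ENNReal.ofReal rf ^ 2) ≠ ∞ := ENNReal.pow_ne_top ENNReal.ofReal_ne_top
    have h1 : (ENNReal.ofReal rf ^ 2)⁻¹ *
        ((∫⁻ w in parabolicCylinder rf (t - h, x), ‖u w.1 w.2‖ₑ ^ (3 : ℕ)) +
          (∫⁻ w in parabolicCylinder rf (t - h, x), ‖p w.1 w.2‖ₑ ^ (3 / 2 : ℝ))) ≤
        ENNReal.ofReal (ε₀ ^ 3) := by
      rw [mul_add]
      exact hstep h hh0 hhr₁ hhrf
    have h2 := mul_le_mul_right h1 (ENNReal.ofReal rf ^ 2)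
    rw [← mul_assoc, ENNReal.mul_inv_cancel hc0 hctop, one_mul] at h2
    refine h2.trans (le_of_eq ?_)
    rw [← ENNReal.ofReal_pow hrf.le, ← ENNReal.ofReal_mul (by positivity), mul_comm]
  -- the conclusion of the one-scale criterion on `Q_{rf/2}(t - h, x)`, uniformly in `h`
  have hbddH : ∀ h, 0 < h → h ≤ r₁ ^ 2 → h ≤ 3 * rf ^ 2 →
      ∀ᵐ w ∂(volume.restrict (parabolicCylinder (rf / 2) (t - h, x))),
        ‖u w.1 w.2‖ ≤ Cε * ε₀ / rf :=
    fun h hh0 hhr₁ hhrf =>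
      H Q u p hsws (t - h, x) rf rf hrf le_rfl (hboxQ h hh0 hhr₁) (hsmallH h hh0 hhr₁ hhrf)
  -- ## exhaust `Q_{rf/2}(t, x)` by the shifted half-cylinders `Q_{rf/2}(t - hₙ, x)`, `hₙ ↓ 0`
  set c₁ : ℝ := min (r₁ ^ 2) (3 * rf ^ 2) with hc₁
  have hc₁0 : 0 < c₁ := lt_min (by positivity) (by positivity)
  set hs : ℕ → ℝ := fun n => c₁ / ((n : ℝ) + 1) with hhs
  have hhs0 : ∀ n, 0 < hs n := fun n => by positivity
  have hhsc : ∀ n, hs n ≤ c₁ := fun n => by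
    rw [hhs]
    exact div_le_self hc₁0.le (by linarith [n.cast_nonneg (α := ℝ)])
  have hcover : parabolicCylinder (rf / 2) (t, x) ⊆
      ⋃ n, parabolicCylinder (rf / 2) (t - hs n, x) := by
    intro w hw
    simp only [mem_iUnion, parabolicCylinder, mem_prod, mem_Ioo] at hw ⊢
    obtain ⟨⟨h1, h2⟩, h3⟩ := hw
    obtain ⟨n, hn⟩ := exists_nat_gt (c₁ / (t - w.1))
    refine ⟨n, ⟨by linarith [hhs0 n], ?_⟩, h3⟩
    have hgap : 0 < t - w.1 := sub_pos.2 h2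
    have : hs n < t - w.1 := by
      rw [hhs, div_lt_iff₀ (by positivity)]
      have := (div_lt_iff₀ hgap).1 hn
      nlinarith
    linarith
  have hU : ∀ᵐ w ∂(volume.restrict (⋃ n, parabolicCylinder (rf / 2) (t - hs n, x))),
      ‖u w.1 w.2‖ ≤ Cε * ε₀ / rf := by
    rw [ae_restrict_iUnion_iff]
    intro n
    exact hbddH (hs n) (hhs0 n) ((hhsc n).trans (min_le_left _ _))
      ((hhsc n).trans (min_le_right _ _))
  refine ⟨rf / 2, by positivity, ?_⟩
  rw [eLpNorm_exponent_top]
  exact eLpNormEssSup_lt_top_of_ae_bound (C := Cε * ε₀ / rf)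
    (ae_restrict_of_ae_restrict_of_subset hcover hU)

/-! ## Lemma 4.2, the top singular set, Lemma 4.1 and Theorem 2 over Thm. 15.3 / Lemma 15.12 -/

/-- **Tsai 1998, Lemma 4.2, from Robinson–Rodrigo–Sadowski's Thm. 15.3** (Caffarelli–Kohn–
Nirenberg's Proposition 1 for suitable pairs on the unit cylinder, `ν = 1`, `f = 0`): the named
fact `tsai1998_lemma42` (every viscosity) follows from `RRS2016.theorem15_3`, the three decay
estimates being discharged (`localEnergyEstimate_holds`, `pressureEstimate_holds`,
`interpolationEstimate_holds`): `tsai1998_lemma42_unit_of_oneScale` fed with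
`epsilonRegularity_one_of_theorem15_3`, then the accepted viscosity rescaling
`tsai1998_lemma42_of_unit`. [cite: Tsai1998, Lemma 4.2 (p. 46); RobinsonRodrigoSadowski2016, Thm. 15.3 p. 220] -/
theorem tsai1998_lemma42_of_theorem15_3 (h15 : RRS2016.theorem15_3) : tsai1998_lemma42 := by
  obtain ⟨ε₀, Cε, hε₀, -, H⟩ := epsilonRegularity_one_of_theorem15_3 h15
  exact tsai1998_lemma42_of_unit (tsai1998_lemma42_unit_of_oneScale localEnergyEstimate_holds
    pressureEstimate_holds interpolationEstimate_holds hε₀ H)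

/-- **Tsai 1998, Lemma 4.2, from Robinson–Rodrigo–Sadowski's Lemma 15.12 alone** (the local
pressure estimate; Thm. 15.3 follows from it by `RRS2016.theorem15_3_of_lemma15_12`, whose other
inputs — Lemma 15.11, Steps 1–4, the interpolation inequality — are proved in the tree).
[cite: Tsai1998, Lemma 4.2 (p. 46); RobinsonRodrigoSadowski2016, Lemma 15.12 pp. 232–234] -/
theorem tsai1998_lemma42_of_lemma15_12 (h12 : RRS2016.lemma15_12) : tsai1998_lemma42 :=
  tsai1998_lemma42_of_theorem15_3 (RRS2016.theorem15_3_of_lemma15_12 h12)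

/-- **The top singular set is `μH[1]`-null, from Thm. 15.3** (Tsai 1998, remark after Lemma 4.2,
p. 46: "this lemma implies that the singular set at the top of the parabolic cylinder also has
one-dimensional Hausdorff measure zero"): `tsai1998_top_singular_null` from `RRS2016.theorem15_3`
through `tsai1998_lemma42_of_theorem15_3` and the proved covering argument
`tsai1998_top_singular_null_of_lemma42`. [cite: Tsai1998, remark after Lemma 4.2 (p. 46)] -/
theorem tsai1998_top_singular_null_of_theorem15_3 (h15 : RRS2016.theorem15_3) :
    tsai1998_top_singular_null :=
  tsai1998_top_singular_null_of_lemma42 (tsai1998_lemma42_of_theorem15_3 h15)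

/-- **Discharge of `tsai1998_lemma41`** (Tsai 1998, Lemma 4.1, p. 46: a weak solution `u` of
(1.1) in `Q₁` of the self-similar form (1.2)₁ satisfying the local energy estimates (1.4) is
smooth and admits a smooth pressure `p ∈ L^{5/3}(Q₁)` of the form (1.2)₂ with which `(u, p)` is a
suitable weak solution in `Q₁`). PROVED: the accepted reduction `tsai1998_lemma41_of_weightedRiesz`
(`TsaiLemma41Proofs.lean`) applied to the discharged weighted Riesz-transform bound
`tsai1998_weightedRieszPressure_holds` (`TsaiWeightedRieszPressureProofs.lean`), as announced in the
module docstring of `TsaiLemma41Proofs.lean`. [cite: Tsai1998, Lemma 4.1 (p. 46)] -/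
theorem tsai1998_lemma41_holds : tsai1998_lemma41 :=
  tsai1998_lemma41_of_weightedRiesz tsai1998_weightedRieszPressure_holds

/-- **Tsai 1998, Theorem 2, from Robinson–Rodrigo–Sadowski's Thm. 15.3** (p. 47, "the first way":
`U` is smooth, `U ∈ L⁴` by Lemma 4.1 and Corollary 4.3, and the endgame of Theorem 1 applies):
the accepted `tsai_selfsimilar_local_energy_of_stokes` with the regularity of profiles
(`tsai1998_profile_smooth_holds`), the interior Stokes estimate
(`stokes_interior_Lr_estimate_holds`), Lemma 4.1 (`tsai1998_lemma41_holds`) and Lemma 4.2 from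
Thm. 15.3 (`tsai1998_lemma42_of_theorem15_3`). [cite: Tsai1998, Theorem 2 (p. 31) and its proof (p. 47)] -/
theorem tsai_selfsimilar_local_energy_of_theorem15_3 (h15 : RRS2016.theorem15_3) :
    tsai_selfsimilar_local_energy :=
  tsai_selfsimilar_local_energy_of_stokes tsai1998_profile_smooth_holds
    stokes_interior_Lr_estimate_holds tsai1998_lemma41_holds (tsai1998_lemma42_of_theorem15_3 h15)

/-- **Tsai 1998, Theorem 2, with trust base `{RRS2016.lemma15_12}`**: the named fact
`tsai_selfsimilar_local_energy` follows from Robinson–Rodrigo–Sadowski's local pressure estimate,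
Lemma 15.12, everything else in the proofs of Thm. 15.3, of Tsai's Lemmas 4.1–4.2, Corollary 4.3,
Lemma 3.2 and of the Liouville endgame being proved in the tree. [cite: Tsai1998, Theorem 2 (p. 31); RobinsonRodrigoSadowski2016, Lemma 15.12 pp. 232–234] -/
theorem tsai_selfsimilar_local_energy_of_lemma15_12 (h12 : RRS2016.lemma15_12) :
    tsai_selfsimilar_local_energy :=
  tsai_selfsimilar_local_energy_of_theorem15_3 (RRS2016.theorem15_3_of_lemma15_12 h12)

/-- **Tsai 1998, Theorem 2, from Lemarié-Rieusset's Thm. 14.4 alone**: the accepted chain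
`tsai_selfsimilar_local_energy_of_weightedRiesz_of_estimates` with Theorem 1
(`tsai_selfsimilar_holds`), the weighted Riesz-transform bound
(`tsai1998_weightedRieszPressure_holds`) and the three decay estimates discharged; kept for the
dependents of Thm. 14.4 (`lemarieRieusset_epsilon_regularity`). [cite: Tsai1998, Theorem 2 (p. 31); LemarieRieusset2016, Thm. 14.4 p. 505] -/
theorem tsai_selfsimilar_local_energy_of_LR (hLR : lemarieRieusset_epsilon_regularity) :
    tsai_selfsimilar_local_energy :=
  tsai_selfsimilar_local_energy_of_weightedRiesz_of_estimates tsai_selfsimilar_holds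
    tsai1998_weightedRieszPressure_holds localEnergyEstimate_holds pressureEstimate_holds
    interpolationEstimate_holds hLR

end Literature.Analysis.FluidPDE

end
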